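import Literature.Barriers.CriticalPhenomena.GaussianDominationRouteDiagramsProp74
import Literature.Barriers.CriticalPhenomena.GaussianDominationRouteProp83OfProp74
import HarnessLib

/-!
# Discharges of named facts of `GaussianDominationRouteImprovement.lean`

`Literature/Barriers/CriticalPhenomena/GaussianDominationRouteImprovementHolds.lean` —
proofs-only sibling of `GaussianDominationRouteImprovement.lean` (no definitions, no named
facts). Each theorem below closes a named fact `X : Prop` of that file as `X_holds : X` by
composing an ACCEPTED reduction theorem of the tree with the ACCEPTED unconditional `_holds`
discharges of all of its hypotheses; nothing is re-proved and no statement is changed.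
Recorded by the librarian sweep g25 (2026-08-16, pass 5c: facts dischargeable in one line from
the tree's own lemmas), so that the facts census, `#h21_route_deps` and the cone guardrail see
these facts as theorems.

Discharged here:

* `HvdH2017_prop83_holds` := `HvdH2017_prop83_of_prop74` `HvdH2017_prop74_holds`
  (`GaussianDominationRouteProp83OfProp74.lean`).

## References

* [HaraSlade1990] — see `lean/references.bib` and the docstring of the fact in `GaussianDominationRouteImprovement.lean`.
* [HeydenreichVanDerHofstad2017] — see `lean/references.bib` and the docstring of the fact in `GaussianDominationRouteImprovement.lean`.
-/

namespace Literature.Barriers.CriticalPhenomena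

/-- **Discharge of the named fact `HvdH2017_prop83`** (`GaussianDominationRouteImprovement.lean`):
NAMED FACT (open node, the lace expansion proper) — Prop. 8.3, "Consequences of the bootstrap
bound", in existential form. Printed: "Let `M = 0, 1, 2, …`. … — obtained as
`HvdH2017_prop83_of_prop74` applied to the tree's unconditional discharge
`HvdH2017_prop74_holds` of its hypothesis (reduction in
`GaussianDominationRouteProp83OfProp74.lean`).
[cite: HeydenreichVanDerHofstad2017, Prop. 8.3 ((8.3.1)–(8.3.4)) with (6.1.2)–(6.1.3), (6.3.3), Lemma 8.4 and p. 74]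
[cite: HaraSlade1990, Lemma 4.5 ((4.4)–(4.6)) and Prop. 2.3] -/
theorem HvdH2017_prop83_holds :
    HvdH2017_prop83 :=
  HvdH2017_prop83_of_prop74 HvdH2017_prop74_holds

end Literature.Barriers.CriticalPhenomena
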